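import Mathlib

/-!
# PercRepro — `C(R, u−3) ≤ C(u,3) · C(R−3, u−3)` for `3 ≤ u ≤ R` (p10, gen 5)

The arithmetic of the fat half of the row `q = 3`: the price `C(ρ(E∖B), u−3) / C(u,3)` of a rank-3 set is at most
`C(R−3, u−3)`, the number of `(u−3)`-subsets of a basis of the contraction by a rank-3 flat.  Proof: three
applications of `C(n, k)·(n+1) = C(n+1, k)·(n+1−k)` give `C(R, k)·(R−k)(R−k−1)(R−k−2) = C(R−3, k)·R(R−1)(R−2)`
with `k = u−3`, and `6·R(R−1)(R−2) ≤ u(u−1)(u−2)·(R−u+3)(R−u+2)(R−u+1)` factor by factor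
(`3(u+t) ≤ u(t+3)`, `2(u+t−1) ≤ (u−1)(t+2)`, `u+t−2 ≤ (u−2)(t+1)` for `u ≥ 3`, `R = u + t`).

* `choose_three_mul_six` — `6 · C(u,3) = u(u−1)(u−2)`;
* `choose_mul_three_factors` — the three-step descent identity;
* **`choose_le_choose_three_mul_choose`** — the bound.
-/

namespace PercRepro.Cogirth

/-- `6 · C(u,3) = u · (u−1) · (u−2)`. -/
theorem choose_three_mul_six (u : ℕ) : u.choose 3 * 6 = u * (u - 1) * (u - 2) := by
  rcases Nat.lt_or_ge u 3 with h | h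
  · interval_cases u <;> simp [Nat.choose_eq_zero_of_lt]
  · obtain ⟨v, rfl⟩ : ∃ v, u = v + 3 := ⟨u - 3, by omega⟩
    have e1 := Nat.choose_succ_right_eq (v + 3) 2
    have e2 := Nat.choose_succ_right_eq (v + 3) 1
    have e3 := Nat.choose_succ_right_eq (v + 3) 0
    rw [Nat.choose_zero_right] at e3
    rw [show v + 3 - 0 = v + 3 by omega] at e3
    rw [show v + 3 - 1 = v + 2 by omega] at e2
    rw [show v + 3 - 2 = v + 1 by omega] at e1
    rw [show v + 3 - 1 = v + 2 by omega, show v + 3 - 2 = v + 1 by omega]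
    -- e3 : C(v+3,1) * 1 = 1 * (v+3); e2 : C(v+3,2) * 2 = C(v+3,1) * (v+2); e1 : C(v+3,3) * 3 = C(v+3,2) * (v+1)
    have : (v + 3).choose 3 * 6 = (v + 3).choose 3 * 3 * 2 := by ring
    rw [this, e1, show (v + 3).choose 2 * (v + 1) * 2 = (v + 3).choose 2 * 2 * (v + 1) by ring, e2,
      show (v + 3).choose 1 * (v + 2) * (v + 1) = (v + 3).choose 1 * 1 * ((v + 2) * (v + 1)) by ring, e3]
    ring

/-- `C(R, k) · (R−k)(R−k−1)(R−k−2) = C(R−3, k) · R(R−1)(R−2)` for `k + 3 ≤ R`. -/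
theorem choose_mul_three_factors {R k : ℕ} (h : k + 3 ≤ R) :
    R.choose k * ((R - k) * (R - k - 1) * (R - k - 2)) = (R - 3).choose k * (R * (R - 1) * (R - 2)) := by
  obtain ⟨m, rfl⟩ : ∃ m, R = m + 3 := ⟨R - 3, by omega⟩
  have e1 := Nat.choose_mul_succ_eq (m + 2) k   -- C(m+2,k)*(m+3) = C(m+3,k)*(m+3-k)
  have e2 := Nat.choose_mul_succ_eq (m + 1) k   -- C(m+1,k)*(m+2) = C(m+2,k)*(m+2-k)
  have e3 := Nat.choose_mul_succ_eq m k         -- C(m,k)*(m+1) = C(m+1,k)*(m+1-k)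
  rw [show m + 3 - 3 = m by omega, show m + 3 - k - 1 = m + 2 - k by omega,
    show m + 3 - k - 2 = m + 1 - k by omega, show m + 3 - 1 = m + 2 by omega,
    show m + 3 - 2 = m + 1 by omega]
  rw [show m + 2 + 1 = m + 3 by omega] at e1
  rw [show m + 1 + 1 = m + 2 by omega] at e2
  calc (m + 3).choose k * ((m + 3 - k) * (m + 2 - k) * (m + 1 - k))
      = ((m + 3).choose k * (m + 3 - k)) * (m + 2 - k) * (m + 1 - k) := by ring
    _ = ((m + 2).choose k * (m + 3)) * (m + 2 - k) * (m + 1 - k) := by rw [← e1]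
    _ = ((m + 2).choose k * (m + 2 - k)) * (m + 3) * (m + 1 - k) := by ring
    _ = ((m + 1).choose k * (m + 2)) * (m + 3) * (m + 1 - k) := by rw [← e2]
    _ = ((m + 1).choose k * (m + 1 - k)) * (m + 2) * (m + 3) := by ring
    _ = (m.choose k * (m + 1)) * (m + 2) * (m + 3) := by rw [← e3]
    _ = m.choose k * ((m + 3) * (m + 2) * (m + 1)) := by ring

/-- `6 · R(R−1)(R−2) ≤ u(u−1)(u−2) · (R−u+3)(R−u+2)(R−u+1)` for `3 ≤ u ≤ R` (factor by factor). -/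
theorem six_mul_le_of_three_le {u t : ℕ} (hu : 3 ≤ u) :
    6 * ((u + t) * (u + t - 1) * (u + t - 2)) ≤ u * (u - 1) * (u - 2) * ((t + 3) * (t + 2) * (t + 1)) := by
  obtain ⟨v, rfl⟩ : ∃ v, u = v + 3 := ⟨u - 3, by omega⟩
  rw [show v + 3 + t - 1 = v + t + 2 by omega, show v + 3 + t - 2 = v + t + 1 by omega,
    show v + 3 - 1 = v + 2 by omega, show v + 3 - 2 = v + 1 by omega]
  have h1 : 3 * (v + 3 + t) ≤ (v + 3) * (t + 3) := by nlinarith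
  have h2 : 2 * (v + t + 2) ≤ (v + 2) * (t + 2) := by nlinarith
  have h3 : v + t + 1 ≤ (v + 1) * (t + 1) := by nlinarith
  calc 6 * ((v + 3 + t) * (v + t + 2) * (v + t + 1))
      = (3 * (v + 3 + t)) * (2 * (v + t + 2)) * (v + t + 1) := by ring
    _ ≤ ((v + 3) * (t + 3)) * ((v + 2) * (t + 2)) * ((v + 1) * (t + 1)) :=
        Nat.mul_le_mul (Nat.mul_le_mul h1 h2) h3
    _ = (v + 3) * (v + 2) * (v + 1) * ((t + 3) * (t + 2) * (t + 1)) := by ring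

/-- **`C(R, u−3) ≤ C(u,3) · C(R−3, u−3)`** for `3 ≤ u ≤ R`. -/
theorem choose_le_choose_three_mul_choose {u R : ℕ} (hu : 3 ≤ u) (huR : u ≤ R) :
    R.choose (u - 3) ≤ u.choose 3 * (R - 3).choose (u - 3) := by
  obtain ⟨t, rfl⟩ : ∃ t, R = u + t := ⟨R - u, by omega⟩
  have hid := choose_mul_three_factors (R := u + t) (k := u - 3) (by omega)
  rw [show u + t - (u - 3) = t + 3 by omega, show t + 3 - 1 = t + 2 by omega,
    show t + 3 - 2 = t + 1 by omega] at hid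
  have h6 := choose_three_mul_six u
  have hpoly := six_mul_le_of_three_le (u := u) (t := t) hu
  have hpos : 0 < (t + 3) * (t + 2) * (t + 1) := by positivity
  -- multiply the claim by the positive `6 · (t+3)(t+2)(t+1)` and use the identity
  have key : (u + t).choose (u - 3) * (6 * ((t + 3) * (t + 2) * (t + 1))) ≤
      u.choose 3 * (u + t - 3).choose (u - 3) * (6 * ((t + 3) * (t + 2) * (t + 1))) := by
    calc (u + t).choose (u - 3) * (6 * ((t + 3) * (t + 2) * (t + 1)))
        = 6 * ((u + t).choose (u - 3) * ((t + 3) * (t + 2) * (t + 1))) := by ring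
      _ = 6 * ((u + t - 3).choose (u - 3) * ((u + t) * (u + t - 1) * (u + t - 2))) := by rw [hid]
      _ = (u + t - 3).choose (u - 3) * (6 * ((u + t) * (u + t - 1) * (u + t - 2))) := by ring
      _ ≤ (u + t - 3).choose (u - 3) * (u * (u - 1) * (u - 2) * ((t + 3) * (t + 2) * (t + 1))) :=
          Nat.mul_le_mul_left _ hpoly
      _ = (u + t - 3).choose (u - 3) * ((u.choose 3 * 6) * ((t + 3) * (t + 2) * (t + 1))) := by rw [h6]
      _ = u.choose 3 * (u + t - 3).choose (u - 3) * (6 * ((t + 3) * (t + 2) * (t + 1))) := by ring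
  exact Nat.le_of_mul_le_mul_right key (by positivity)

end PercRepro.Cogirth
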